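import Summits.RiemannHypothesis.RiemannHypothesis.Theorems.Splittings.LinearRayOnePointCheck
import Summits.RiemannHypothesis.RiemannHypothesis.Theorems.Splittings.LinearRayCuspSign

/-!
# The a₀ GAP of the linear ray is closed: `linearFactorH a` has a non-real zero for EVERY `0 < |a| < π/8`
# (cell rh-split, C15 / S-dbn-1; certified computation)

ONE `native_decide` evaluation of the one-point check (`Theorems/Splittings/LinearRayOnePointDefs.lean`,
soundness `…EvalCells/EvalTail/Check.lean`): at `s = 8458/25 = 338.32` (just past the `H_0`-zero
`2γ₆₃ = 338.189…` of the close pair `γ₆₃ = 169.0945…`, `γ₆₄ = 169.9119…`), with `210` forward Gauss–Legendre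
y-cells of half-width `ρ_y = 1` (Cauchy radius `R_y = 12`) and the low-window u-context
`mkOsaCtx 256 90 64 20 3 400 1 10 64 6` of the medium-kernel engine, the certificate
`(K Re H_0(s))² < K Q_a(s) · (a K Re H_0(s) − K Re H_0′(s))`, `K = 2¹⁸⁰`, holds for every `a ∈ [0.3193, 0.3195]`
(design numerics: `K h ∈ [−0.0357, −0.0294]`, `K h′ ∈ [−0.2259, −0.2188]`, `K Q ∈ [0.2493, 0.2787]`,
`(K h)² ≤ 0.00128 < 0.0517 ≤ K²Q(ah − h′)`).  The box covers the gap `(0.31935, 0.31945) ∋ a₀ = 0.31941…`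
left by the residue-sign theorems (`LinearRayResidueCells`, `LinearRayCuspSign`: there `∫₀^∞ H_0 cosh(a·) ≠ 0`
is needed, and it vanishes at `a₀`).  Results: `not_hasOnlyRealZeros_linearFactorH_of_mem_gapBox`
(`a ∈ [0.3193, 0.3195]`), `…_of_abs_mem_gapBox`, and the gap-free
**`exists_nonreal_zero_linearFactorH_of_abs_lt_pi_div_eight : a ≠ 0 → |a| < π/8 → ∃ z, linearFactorH a z = 0 ∧ z.im ≠ 0`**.
Axioms: propext, Classical.choice, Quot.sound + the `native_decide` axiom of `linRayGap_check` (filed `--computational`).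
HONEST LABEL: machinery refuting an RH-STRENGTHENING conjunct (the linear-factor ray of
`Literature/Barriers/RiemannHypothesis/NewmanConjecture.lean`); RH-free; nothing here bears on the truth of RH.
Provenance: rh-splitx-eng-5 g3 (cell rh-split, D-0116 arm; C15 / S-dbn-1 filler → kernel), monolith
`HOME/rh-splitx-eng-5/ray/LinearRayOnePointMono.lean`.
-/

set_option linter.dupNamespace false

noncomputable section

namespace Summit.RiemannHypothesis.RiemannHypothesis.Theorems.Splittings.LinearRayOnePoint

open MeasureTheory Set
open Literature.NumberTheory.LFunctions
open Literature.Analysis.ValidatedNumerics Literature.Analysis.ValidatedNumerics.NumericsMP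
open Literature.Barriers.RiemannHypothesis (linearFactorH hasOnlyRealZeros_linearFactorH_neg_iff)
open Summit.RiemannHypothesis.RiemannHypothesis.Theorems

/-- **The certified computation** (`native_decide`; the only computational step of this file): the
one-point check passes at `s = 338.32` for the box `a ∈ [3193/10⁴, 3195/10⁴]` with common scale `2¹⁸⁰`
(design numerics: `K·Re H_0(s) ∈ [−0.0357, −0.0294]`, `K·Re H_0′(s) ∈ [−0.2259, −0.2188]`,
`K·Q_a(s) ∈ [0.2493, 0.2787]`, `(K h)² ≤ 0.00128 < 0.0517 ≤ K²Q(ah − h′)`). [folklore] -/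
theorem linRayGap_check :
    linRayCheck { xn := 8458, xd := 25, rhoYn := 1, rhoYd := 1, RYn := 12, RYd := 1, CyB := 0, CyF := 210, dip := false }
      3193 3195 10000 180 = true := by
  native_decide

/-- **The gap box**: for every `a ∈ [0.3193, 0.3195]` the linear-factor deformation `linearFactorH a`
does NOT have only real zeros (one-point Laguerre certificate at `s = 338.32`). [folklore] -/
theorem not_hasOnlyRealZeros_linearFactorH_of_mem_gapBox {a : ℝ} (h1 : (3193 : ℝ) / 10000 ≤ a)
    (h2 : a ≤ (3195 : ℝ) / 10000) : ¬ HasOnlyRealZeros (linearFactorH a) :=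
  linRayCheck_sound linRayGap_check (by exact_mod_cast h1) (by exact_mod_cast h2)

/-- The gap box in `|a|` (mirror symmetry `linearFactorH (−a) z = linearFactorH a (−z)`). [folklore] -/
theorem not_hasOnlyRealZeros_linearFactorH_of_abs_mem_gapBox {a : ℝ} (h1 : (3193 : ℝ) / 10000 ≤ |a|)
    (h2 : |a| ≤ (3195 : ℝ) / 10000) : ¬ HasOnlyRealZeros (linearFactorH a) := by
  rcases le_or_gt 0 a with ha | ha
  · rw [abs_of_nonneg ha] at h1 h2
    exact not_hasOnlyRealZeros_linearFactorH_of_mem_gapBox h1 h2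
  · rw [abs_of_neg ha] at h1 h2
    exact fun h => not_hasOnlyRealZeros_linearFactorH_of_mem_gapBox h1 h2
      ((hasOnlyRealZeros_linearFactorH_neg_iff a).2 h)

/-- **THE WIDE WINDOW OF THE LINEAR RAY IS CLOSED, WITHOUT A GAP**: for every `a ≠ 0` with `|a| < π/8` the
linear-factor deformation `linearFactorH a` of `Literature/Barriers/RiemannHypothesis/NewmanConjecture.lean`
has a non-real zero.  Outside `(0.31935, 0.31945)` this is the tree's residue-sign theorem
(`LinearRayCusp.LinearRayWideWindow.exists_nonreal_zero_linearFactorH_of_lt_pi_div_eight`: theta cells,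
cusp transformation); on the gap box `[0.3193, 0.3195] ∋ a₀ = 0.31941…`, where the residue
`∫₀^∞ H_0 cosh(a·)` vanishes and no residue argument can work, it is the one-point Laguerre certificate
above.  RH-free; the ray is RH-strengthening, so nothing here bears on the truth of RH. [folklore] -/
theorem exists_nonreal_zero_linearFactorH_of_abs_lt_pi_div_eight {a : ℝ} (ha : a ≠ 0)
    (h1 : |a| < Real.pi / 8) : ∃ z : ℂ, linearFactorH a z = 0 ∧ z.im ≠ 0 := by
  by_cases hgap : |a| ≤ 31935 / 100000 ∨ 31945 / 100000 ≤ |a|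
  · exact LinearRayCusp.LinearRayWideWindow.exists_nonreal_zero_linearFactorH_of_lt_pi_div_eight ha h1 hgap
  · push Not at hgap
    have h : ¬ HasOnlyRealZeros (linearFactorH a) :=
      not_hasOnlyRealZeros_linearFactorH_of_abs_mem_gapBox (by linarith [hgap.1]) (by linarith [hgap.2])
    unfold HasOnlyRealZeros at h
    push Not at h
    exact h

/-- Corollary: no slope `0 < |a| < π/8` of the linear-factor ray has only real zeros. [folklore] -/
theorem not_hasOnlyRealZeros_linearFactorH_of_abs_lt_pi_div_eight {a : ℝ} (ha : a ≠ 0)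
    (h1 : |a| < Real.pi / 8) : ¬ HasOnlyRealZeros (linearFactorH a) := by
  obtain ⟨z, hz, hzim⟩ := exists_nonreal_zero_linearFactorH_of_abs_lt_pi_div_eight ha h1
  exact fun h => hzim (h z hz)

end Summit.RiemannHypothesis.RiemannHypothesis.Theorems.Splittings.LinearRayOnePoint

end
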